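import Summits.BirchSwinnertonDyer.BirchSwinnertonDyer.Theorems.SignedLowerHalvesKobayashiMainConjectureSmallImageCMTransferRecordsA
import HarnessLib

/-!
# Route `SignedLowerHalves`, crux `KobayashiMainConjectureSmallImage` (item stmt-BirchSwinnertonDyer-19002) —
# the CM-congruence transfer line (L4-CM), UNIT CASE, part D: per-pair records 5 pairs at `p = 3` (partner `64a4 : y² = x³ + x` (`j = 1728`))
# (cell `bsd-ssimc`, seat `bsd-ssimc-k3-c4` gen 2)

HONEST FRAMING: Kobayashi's signed main conjecture at a non-surjective (normaliser-of-non-split-Cartan) image is OPEN;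
nothing here proves it for any class. Every record below is CONDITIONAL on the explicitly labelled OPEN binder
`CorpuzLei2025_signedMainConjecture_transfer_OPEN` (Corpuz–Lei, arXiv:2508.09733, 2025, UNREFEREED preprint), taken as
the hypothesis `hCL` and never asserted, and on PUBLISHED results consumed BY NAME (`hPR` Pollack–Rubin 2004; `h5`/`h3`
period-unit comparisons; at `p = 3` the Hesse facts are PROVED in the tree and the congruences are UNCONDITIONAL). Per pair; item 4 stays OPEN; nothing is booked; BSD is not proved by any of this.

## What this file does (our own work, hence `Summits/…/Theorems`)

Part A (`…CMTransferRecordsA.lean`) proved the UNIT CASE of the line as a kernel theorem,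
`kobayashiMainConjecture_of_cmPartner_of_lvalue_of_transfer_OPEN`: `E = W` (odd good `p`, `a_p = 0`, ANY image) with
a CM partner `E'` congruent mod `p` and ONE `L`-value certificate `L(E',1)/Ω(E') = q`, `ord_p q = 0` ⟹
`∀ ε, KobayashiMainConjecture W p ε` modulo the binder. This part instantiates it for 5 of the 23 unit-case
window pairs of the seat's census (k3c4 MEMO-1 add. E; certificates kit j250394 = PARI + the seat's exact Python
re-derivation `work/hesse_cert.py`, 79/79): `26048l1 @ 3`, `111296l1 @ 3`, `111296m1 @ 3`, `311872h1 @ 3`, `351808bj1 @ 3` — CM partner `64a4 : y² = x³ + x` (`j = 1728`). The CM partner data (point count at `p`, `Δ ≠ 0`, Kraus minimality, CM by `j`) of `64a4 : y² = x³ + x` (`j = 1728`) are decided in THIS file (32a2's are in part A). The window curves' own ellipticity / minimality enter only as the instance binders `[W.IsElliptic] [W.IsGloballyMinimal]` (Cremona models). Per pair, DECIDED IN THE KERNEL from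
the two integer models: `p ∤ Δ`, `#Ẽ(𝔽_p) = #Ẽ'(𝔽_p) = p + 1` (`a_p = 0`), CM of
`E'` (`j ∈ cmJInvariants`), and the congruence `E[p] ≃ E'[p]`: an UNCONDITIONAL kernel theorem (`threeCongruent_of_{hesse,dualHesse}Certificate_unconditional`: Fisher 2012 Thm. 13.2 / §13 for `n = 3` are PROVED in the tree; the two covariant identities by `norm_num`).
Displayed certificate binder per record: `hL'` = `L(E',1)/Ω(E') = q` (two engines: PARI `ellL1`/`omega`, kit j250436;
the cell's PARI-free modular-symbol engine `[0]⁺`, kit j251201); `q ≠ 0` and `ord_p q = 0` decided.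

References: [CorpuzLei2025] Thms 1–3; [PollackRubin2004] Thm. (p. 448); [Kobayashi2003] Conj. (p. 2), (3.6);
[Kurihara2002] Thm. 0.1; [GreenbergVatsal2000] (2), §3 Rem. 3.4; [Fisher2012Hessian] §8, §13, Thm. 13.2;
[Fisher2013QuinticTwists] Thm. 5.8; [SilvermanAEC2009] III §1, VII.1, App. C §11; [Cremona2006] Table 1.
-/

set_option autoImplicit false
set_option linter.dupNamespace false

noncomputable section

open scoped Classical MatrixGroups ModularForm

open CongruenceSubgroup WeierstrassCurve Literature.NumberTheory.EllipticCurves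
  Literature.NumberTheory.EllipticCurves.ModularForms
  Literature.NumberTheory.EllipticCurves.Kobayashi2003 ZpExtension
  Literature.NumberTheory.EllipticCurves.GreenbergVatsal2000
  Literature.NumberTheory.EllipticCurves.Rank1Residual
  Literature.NumberTheory.EllipticCurves.Rank1Residual.Typed
  Literature.NumberTheory.EllipticCurves.Rank1Residual.X11RankOneCertificates
  Literature.NumberTheory.EllipticCurves.Fisher2012
  Summit.BirchSwinnertonDyer.BirchSwinnertonDyer.Rank1Residual.IntModel
  Summit.BirchSwinnertonDyer.BirchSwinnertonDyer.Rank1Residual.X11RankOne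
  Summit.BirchSwinnertonDyer.Rank1Residual.X11b
  Summit.BirchSwinnertonDyer.Rank1Residual.X9
  Summit.BirchSwinnertonDyer.Rank1Residual.X1
  Summit.BirchSwinnertonDyer.Rank1Residual.Supersingular

namespace Summit.BirchSwinnertonDyer.BirchSwinnertonDyer.Theorems

/-- `#{Ẽ'(𝔽_3)} = 4` for the CM partner `64a4 : y² = x³ + x` (`j = 1728`) (`a_3 = 0`: good SUPERSINGULAR; kernel count). [folklore] -/
theorem card_cm64a4_3 :
    Nat.card (((⟨0, 0, 0, 1, 0⟩ : WeierstrassCurve ℤ).map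
      (Int.castRingHom (ZMod 3))).toAffine.Point) = 4 := by
  rw [@WeierstrassCurve.natCard_point_eq_one_add_card (ZMod 3) (@ZMod.instField 3 ⟨by norm_num⟩) _ _ _
    (by decide +kernel), @card_sol_eq_sum_euler (ZMod 3) (@ZMod.instField 3 ⟨by norm_num⟩) _ _
    (by rw [ZMod.ringChar_zmod_n]; decide), ZMod.card]
  decide +kernel

/-- The CM partner `64a4 : y² = x³ + x` (`j = 1728`) is an elliptic curve (`Δ ≠ 0`, kernel). [folklore] -/
theorem isElliptic_cm64a4 : (⟨0, 0, 0, 1, 0⟩ : WeierstrassCurve ℚ).IsElliptic :=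
  isElliptic_of_discOf_ne_zero 0 0 0 1 0 (by decide +kernel)

/-- The CM partner `64a4 : y² = x³ + x` (`j = 1728`) is globally minimal (Kraus' bounded criterion, kernel). [cite: SilvermanAEC2009, VII.1 Remark 1.1] -/
theorem isGloballyMinimal_cm64a4 : (⟨0, 0, 0, 1, 0⟩ : WeierstrassCurve ℚ).IsGloballyMinimal :=
  isGloballyMinimal_of_krausCriterion_bounded₂ 0 0 0 1 0 (by decide +kernel) (by decide +kernel)
    (by decide +kernel)

/-- The CM partner `64a4 : y² = x³ + x` (`j = 1728`) has CM (`j = 1728 ∈` the thirteen CM values), for any globally minimal `A` with this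
integral model. [cite: SilvermanAEC2009, App. C §11] -/
theorem hasCM_cm64a4 {A : WeierstrassCurve ℚ} [A.IsElliptic] [A.IsGloballyMinimal]
    (hIA : integralModelInt A = ⟨0, 0, 0, 1, 0⟩) : A.HasCM :=
  (hasCM_iff_j_mem_holds A).mpr (by rw [j_eq_of_intModel 0 0 0 1 0 hIA]; decide +kernel)

/-- `#{Ẽ(𝔽_3)} = 4` for the Cremona model of `26048l1` (`a_3 = 0`: good SUPERSINGULAR; kernel count).
[cite: Cremona2006, Table 1 (Cremona label 26048l1)] -/
theorem card_c26048l1_3 :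
    Nat.card (((⟨0, 0, 0, -18659, -675640⟩ : WeierstrassCurve ℤ).map
      (Int.castRingHom (ZMod 3))).toAffine.Point) = 4 := by
  rw [@WeierstrassCurve.natCard_point_eq_one_add_card (ZMod 3) (@ZMod.instField 3 ⟨by norm_num⟩) _ _ _
    (by decide +kernel), @card_sol_eq_sum_euler (ZMod 3) (@ZMod.instField 3 ⟨by norm_num⟩) _ _
    (by rw [ZMod.ringChar_zmod_n]; decide), ZMod.card]
  decide +kernel

/-- **Kobayashi's ± main conjecture, BOTH signs, for `26048l1 @ 3`** (Cremona model `[0, 0, 0, -18659, -675640]`, `N = 26048 = 2⁶·11·37`,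
`r_an = 0`; item-4 pair: X7, `a_3 = 0`, image `3Nn`) **by CM-congruence transfer from `E' =` `64a4 : y² = x³ + x` (`j = 1728`), MODULO the OPEN
binder `hCL` (Corpuz–Lei 2025, PRE)**: `E ≅_ℚ` the member `(λ:μ) = (8:5)` of the Hesse pencil `X_{E'}(3)`, `u = 4/5` (`threeCongruent_of_hesseCertificate_unconditional` — Fisher's `n = 3` fact is PROVED in the tree, so `E[3] ≃ E'[3]` is UNCONDITIONAL); covariant identities by `norm_num`. BY NAME: `hPR`, `h5`, `h3`.
Certificate binder `hL'`: `L(E',1)/Ω(E') = 1/4` (engines PARI kit j250436 / PARI-free modular symbols kit j251201), a `3`-unit (kernel).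
Kernel-decided (models as instance binders): `3 ∤ Δ` (both), `#Ẽ(𝔽_3) = #Ẽ'(𝔽_3) = 4`, CM of `E'`. Per pair; item 4 stays OPEN; nothing booked.
[claim: CorpuzLei2025, status: under-review] [cite: PollackRubin2004, Theorem (p. 448) = Thm. 7.3]
[cite: Fisher2012Hessian, Thm. 13.2 (n = 3)] [cite: Cremona2006, Table 1 (Cremona label 26048l1)] -/
theorem kobayashiMainConjecture_c26048l1_3_of_transfer_OPEN
    (hCL : CorpuzLei2025_signedMainConjecture_transfer_OPEN)
    (hPR : PollackRubin2004.mainTheorem_signedCharIdeal_eq_of_cm)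
    (h5 : realPeriodRat_eq_unit_mul_plusPeriod) (h3 : realPeriodRat_eq_unit_mul_plusPeriod_three)
    (W A : WeierstrassCurve ℚ) [W.IsElliptic] [W.IsGloballyMinimal] [A.IsElliptic] [A.IsGloballyMinimal]
    [Fact (Nat.Prime 3)] (hW : W = ⟨0, 0, 0, -18659, -675640⟩) (hA : A = ⟨0, 0, 0, 1, 0⟩)
    (hL' : A.entireLFunction 1 / (A.realPeriodRat : ℂ) = ((1 / 4 : ℚ) : ℂ)) (ε : ℤˣ) :
    KobayashiMainConjecture W 3 ε := by
  have hIW : integralModelInt W = ⟨0, 0, 0, -18659, -675640⟩ :=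
    integralModelInt_eq_of_map_eq _ (by rw [hW]; ext <;> simp [WeierstrassCurve.map])
  have hIA : integralModelInt A = ⟨0, 0, 0, 1, 0⟩ :=
    integralModelInt_eq_of_map_eq _ (by rw [hA]; ext <;> simp [WeierstrassCurve.map])
  have hΔ : (⟨0, 0, 0, -18659, -675640⟩ : WeierstrassCurve ℤ).Δ = discOf [0, 0, 0, -18659, -675640] :=
    intCurve_Δ 0 0 0 (-18659) (-675640)
  have hΔA : (⟨0, 0, 0, 1, 0⟩ : WeierstrassCurve ℤ).Δ = discOf [0, 0, 0, 1, 0] :=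
    intCurve_Δ 0 0 0 1 0
  have hgood : W.HasGoodReductionAtPrime 3 :=
    hasGoodReductionAtPrime_of_not_dvd W 3 (by rw [minimalDiscriminantInt_eq hIW, hΔ]; decide +kernel)
  have hgoodA : A.HasGoodReductionAtPrime 3 :=
    hasGoodReductionAtPrime_of_not_dvd A 3 (by rw [minimalDiscriminantInt_eq hIA, hΔA]; decide +kernel)
  have hap : W.frobeniusTrace 3 = 0 := by rw [frobeniusTrace_eq hIW card_c26048l1_3]; norm_num
  have hapA : A.frobeniusTrace 3 = 0 := by rw [frobeniusTrace_eq hIA card_cm64a4_3]; norm_num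
  have hc4 : W.c₄ = (895632 : ℚ) := by
    subst hW; norm_num [WeierstrassCurve.c₄, WeierstrassCurve.b₂, WeierstrassCurve.b₄]
  have hc6 : W.c₆ = (583752960 : ℚ) := by
    subst hW; norm_num [WeierstrassCurve.c₆, WeierstrassCurve.b₂, WeierstrassCurve.b₄, WeierstrassCurve.b₆]
  have hc4A : A.c₄ = (-48 : ℚ) := by
    subst hA; norm_num [WeierstrassCurve.c₄, WeierstrassCurve.b₂, WeierstrassCurve.b₄]
  have hc6A : A.c₆ = (0 : ℚ) := by
    subst hA; norm_num [WeierstrassCurve.c₆, WeierstrassCurve.b₂, WeierstrassCurve.b₄, WeierstrassCurve.b₆]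
  have hiso := threeCongruent_of_hesseCertificate_unconditional A W ((8 : ℚ) / 5) 1 ((4 : ℚ) / 5)
    (by norm_num) (by rw [hc4A, hc6A, hc4, eval_hesseC4three]; norm_num)
    (by rw [hc4A, hc6A, hc6, eval_hesseC6three]; norm_num)
  exact kobayashiMainConjecture_of_cmPartner_of_lvalue_of_transfer_OPEN W A 3 hCL hPR h5 h3 (by norm_num)
    hgood hap (hasCM_cm64a4 hIA) hgoodA hapA hiso (by norm_num) hL'
    (by rw [show ((1 : ℚ) / 4) = ((1 : ℕ) : ℚ) / (4 : ℕ) by norm_num]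
        exact padicValRat_natCast_div_natCast_eq_zero 3 1 4 (by norm_num) (by norm_num)) ε

/-- `#{Ẽ(𝔽_3)} = 4` for the Cremona model of `111296l1` (`a_3 = 0`: good SUPERSINGULAR; kernel count).
[cite: Cremona2006, Table 1 (Cremona label 111296l1)] -/
theorem card_c111296l1_3 :
    Nat.card (((⟨0, 0, 0, 3356, 50256192⟩ : WeierstrassCurve ℤ).map
      (Int.castRingHom (ZMod 3))).toAffine.Point) = 4 := by
  rw [@WeierstrassCurve.natCard_point_eq_one_add_card (ZMod 3) (@ZMod.instField 3 ⟨by norm_num⟩) _ _ _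
    (by decide +kernel), @card_sol_eq_sum_euler (ZMod 3) (@ZMod.instField 3 ⟨by norm_num⟩) _ _
    (by rw [ZMod.ringChar_zmod_n]; decide), ZMod.card]
  decide +kernel

/-- **Kobayashi's ± main conjecture, BOTH signs, for `111296l1 @ 3`** (Cremona model `[0, 0, 0, 3356, 50256192]`, `N = 111296 = 2⁶·37·47`,
`r_an = 0`; item-4 pair: X7, `a_3 = 0`, image `3Nn`) **by CM-congruence transfer from `E' =` `64a4 : y² = x³ + x` (`j = 1728`), MODULO the OPEN
binder `hCL` (Corpuz–Lei 2025, PRE)**: `E ≅_ℚ` the member `(λ:μ) = (14:3)` of the DUAL Hesse pencil `X⁻_{E'}(3)`, `u = 1/144` (`threeCongruent_of_dualHesseCertificate_unconditional` — Fisher's `n = 3` dual fact is PROVED in the tree, so `E[3] ≃ E'[3]` is UNCONDITIONAL); covariant identities by `norm_num`. BY NAME: `hPR`, `h5`, `h3`.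
Certificate binder `hL'`: `L(E',1)/Ω(E') = 1/4` (engines PARI kit j250436 / PARI-free modular symbols kit j251201), a `3`-unit (kernel).
Kernel-decided (models as instance binders): `3 ∤ Δ` (both), `#Ẽ(𝔽_3) = #Ẽ'(𝔽_3) = 4`, CM of `E'`. Per pair; item 4 stays OPEN; nothing booked.
[claim: CorpuzLei2025, status: under-review] [cite: PollackRubin2004, Theorem (p. 448) = Thm. 7.3]
[cite: Fisher2012Hessian, §13 (analogue of Thm. 13.2 for X_E^-(3))] [cite: Cremona2006, Table 1 (Cremona label 111296l1)] -/
theorem kobayashiMainConjecture_c111296l1_3_of_transfer_OPEN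
    (hCL : CorpuzLei2025_signedMainConjecture_transfer_OPEN)
    (hPR : PollackRubin2004.mainTheorem_signedCharIdeal_eq_of_cm)
    (h5 : realPeriodRat_eq_unit_mul_plusPeriod) (h3 : realPeriodRat_eq_unit_mul_plusPeriod_three)
    (W A : WeierstrassCurve ℚ) [W.IsElliptic] [W.IsGloballyMinimal] [A.IsElliptic] [A.IsGloballyMinimal]
    [Fact (Nat.Prime 3)] (hW : W = ⟨0, 0, 0, 3356, 50256192⟩) (hA : A = ⟨0, 0, 0, 1, 0⟩)
    (hL' : A.entireLFunction 1 / (A.realPeriodRat : ℂ) = ((1 / 4 : ℚ) : ℂ)) (ε : ℤˣ) :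
    KobayashiMainConjecture W 3 ε := by
  have hIW : integralModelInt W = ⟨0, 0, 0, 3356, 50256192⟩ :=
    integralModelInt_eq_of_map_eq _ (by rw [hW]; ext <;> simp [WeierstrassCurve.map])
  have hIA : integralModelInt A = ⟨0, 0, 0, 1, 0⟩ :=
    integralModelInt_eq_of_map_eq _ (by rw [hA]; ext <;> simp [WeierstrassCurve.map])
  have hΔ : (⟨0, 0, 0, 3356, 50256192⟩ : WeierstrassCurve ℤ).Δ = discOf [0, 0, 0, 3356, 50256192] :=
    intCurve_Δ 0 0 0 3356 50256192
  have hΔA : (⟨0, 0, 0, 1, 0⟩ : WeierstrassCurve ℤ).Δ = discOf [0, 0, 0, 1, 0] :=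
    intCurve_Δ 0 0 0 1 0
  have hgood : W.HasGoodReductionAtPrime 3 :=
    hasGoodReductionAtPrime_of_not_dvd W 3 (by rw [minimalDiscriminantInt_eq hIW, hΔ]; decide +kernel)
  have hgoodA : A.HasGoodReductionAtPrime 3 :=
    hasGoodReductionAtPrime_of_not_dvd A 3 (by rw [minimalDiscriminantInt_eq hIA, hΔA]; decide +kernel)
  have hap : W.frobeniusTrace 3 = 0 := by rw [frobeniusTrace_eq hIW card_c111296l1_3]; norm_num
  have hapA : A.frobeniusTrace 3 = 0 := by rw [frobeniusTrace_eq hIA card_cm64a4_3]; norm_num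
  have hc4 : W.c₄ = (-161088 : ℚ) := by
    subst hW; norm_num [WeierstrassCurve.c₄, WeierstrassCurve.b₂, WeierstrassCurve.b₄]
  have hc6 : W.c₆ = (-43421349888 : ℚ) := by
    subst hW; norm_num [WeierstrassCurve.c₆, WeierstrassCurve.b₂, WeierstrassCurve.b₄, WeierstrassCurve.b₆]
  have hc4A : A.c₄ = (-48 : ℚ) := by
    subst hA; norm_num [WeierstrassCurve.c₄, WeierstrassCurve.b₂, WeierstrassCurve.b₄]
  have hc6A : A.c₆ = (0 : ℚ) := by
    subst hA; norm_num [WeierstrassCurve.c₆, WeierstrassCurve.b₂, WeierstrassCurve.b₄, WeierstrassCurve.b₆]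
  have hiso := threeCongruent_of_dualHesseCertificate_unconditional A W ((14 : ℚ) / 3) 1 ((1 : ℚ) / 144)
    (by norm_num) (by rw [hc4A, hc6A, hc4, eval_hesseD3]; norm_num)
    (by rw [hc4A, hc6A, hc6, eval_hesseC6three]; norm_num)
  exact kobayashiMainConjecture_of_cmPartner_of_lvalue_of_transfer_OPEN W A 3 hCL hPR h5 h3 (by norm_num)
    hgood hap (hasCM_cm64a4 hIA) hgoodA hapA hiso (by norm_num) hL'
    (by rw [show ((1 : ℚ) / 4) = ((1 : ℕ) : ℚ) / (4 : ℕ) by norm_num]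
        exact padicValRat_natCast_div_natCast_eq_zero 3 1 4 (by norm_num) (by norm_num)) ε

/-- `#{Ẽ(𝔽_3)} = 4` for the Cremona model of `111296m1` (`a_3 = 0`: good SUPERSINGULAR; kernel count).
[cite: Cremona2006, Table 1 (Cremona label 111296m1)] -/
theorem card_c111296m1_3 :
    Nat.card (((⟨0, 0, 0, -338924, -75948048⟩ : WeierstrassCurve ℤ).map
      (Int.castRingHom (ZMod 3))).toAffine.Point) = 4 := by
  rw [@WeierstrassCurve.natCard_point_eq_one_add_card (ZMod 3) (@ZMod.instField 3 ⟨by norm_num⟩) _ _ _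
    (by decide +kernel), @card_sol_eq_sum_euler (ZMod 3) (@ZMod.instField 3 ⟨by norm_num⟩) _ _
    (by rw [ZMod.ringChar_zmod_n]; decide), ZMod.card]
  decide +kernel

/-- **Kobayashi's ± main conjecture, BOTH signs, for `111296m1 @ 3`** (Cremona model `[0, 0, 0, -338924, -75948048]`, `N = 111296 = 2⁶·37·47`,
`r_an = 0`; item-4 pair: X7, `a_3 = 0`, image `3Nn`) **by CM-congruence transfer from `E' =` `64a4 : y² = x³ + x` (`j = 1728`), MODULO the OPEN
binder `hCL` (Corpuz–Lei 2025, PRE)**: `E ≅_ℚ` the member `(λ:μ) = (44:9)` of the Hesse pencil `X_{E'}(3)`, `u = 4/9` (`threeCongruent_of_hesseCertificate_unconditional` — Fisher's `n = 3` fact is PROVED in the tree, so `E[3] ≃ E'[3]` is UNCONDITIONAL); covariant identities by `norm_num`. BY NAME: `hPR`, `h5`, `h3`.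
Certificate binder `hL'`: `L(E',1)/Ω(E') = 1/4` (engines PARI kit j250436 / PARI-free modular symbols kit j251201), a `3`-unit (kernel).
Kernel-decided (models as instance binders): `3 ∤ Δ` (both), `#Ẽ(𝔽_3) = #Ẽ'(𝔽_3) = 4`, CM of `E'`. Per pair; item 4 stays OPEN; nothing booked.
[claim: CorpuzLei2025, status: under-review] [cite: PollackRubin2004, Theorem (p. 448) = Thm. 7.3]
[cite: Fisher2012Hessian, Thm. 13.2 (n = 3)] [cite: Cremona2006, Table 1 (Cremona label 111296m1)] -/
theorem kobayashiMainConjecture_c111296m1_3_of_transfer_OPEN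
    (hCL : CorpuzLei2025_signedMainConjecture_transfer_OPEN)
    (hPR : PollackRubin2004.mainTheorem_signedCharIdeal_eq_of_cm)
    (h5 : realPeriodRat_eq_unit_mul_plusPeriod) (h3 : realPeriodRat_eq_unit_mul_plusPeriod_three)
    (W A : WeierstrassCurve ℚ) [W.IsElliptic] [W.IsGloballyMinimal] [A.IsElliptic] [A.IsGloballyMinimal]
    [Fact (Nat.Prime 3)] (hW : W = ⟨0, 0, 0, -338924, -75948048⟩) (hA : A = ⟨0, 0, 0, 1, 0⟩)
    (hL' : A.entireLFunction 1 / (A.realPeriodRat : ℂ) = ((1 / 4 : ℚ) : ℂ)) (ε : ℤˣ) :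
    KobayashiMainConjecture W 3 ε := by
  have hIW : integralModelInt W = ⟨0, 0, 0, -338924, -75948048⟩ :=
    integralModelInt_eq_of_map_eq _ (by rw [hW]; ext <;> simp [WeierstrassCurve.map])
  have hIA : integralModelInt A = ⟨0, 0, 0, 1, 0⟩ :=
    integralModelInt_eq_of_map_eq _ (by rw [hA]; ext <;> simp [WeierstrassCurve.map])
  have hΔ : (⟨0, 0, 0, -338924, -75948048⟩ : WeierstrassCurve ℤ).Δ = discOf [0, 0, 0, -338924, -75948048] :=
    intCurve_Δ 0 0 0 (-338924) (-75948048)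
  have hΔA : (⟨0, 0, 0, 1, 0⟩ : WeierstrassCurve ℤ).Δ = discOf [0, 0, 0, 1, 0] :=
    intCurve_Δ 0 0 0 1 0
  have hgood : W.HasGoodReductionAtPrime 3 :=
    hasGoodReductionAtPrime_of_not_dvd W 3 (by rw [minimalDiscriminantInt_eq hIW, hΔ]; decide +kernel)
  have hgoodA : A.HasGoodReductionAtPrime 3 :=
    hasGoodReductionAtPrime_of_not_dvd A 3 (by rw [minimalDiscriminantInt_eq hIA, hΔA]; decide +kernel)
  have hap : W.frobeniusTrace 3 = 0 := by rw [frobeniusTrace_eq hIW card_c111296m1_3]; norm_num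
  have hapA : A.frobeniusTrace 3 = 0 := by rw [frobeniusTrace_eq hIA card_cm64a4_3]; norm_num
  have hc4 : W.c₄ = (16268352 : ℚ) := by
    subst hW; norm_num [WeierstrassCurve.c₄, WeierstrassCurve.b₂, WeierstrassCurve.b₄]
  have hc6 : W.c₆ = (65619113472 : ℚ) := by
    subst hW; norm_num [WeierstrassCurve.c₆, WeierstrassCurve.b₂, WeierstrassCurve.b₄, WeierstrassCurve.b₆]
  have hc4A : A.c₄ = (-48 : ℚ) := by
    subst hA; norm_num [WeierstrassCurve.c₄, WeierstrassCurve.b₂, WeierstrassCurve.b₄]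
  have hc6A : A.c₆ = (0 : ℚ) := by
    subst hA; norm_num [WeierstrassCurve.c₆, WeierstrassCurve.b₂, WeierstrassCurve.b₄, WeierstrassCurve.b₆]
  have hiso := threeCongruent_of_hesseCertificate_unconditional A W ((44 : ℚ) / 9) 1 ((4 : ℚ) / 9)
    (by norm_num) (by rw [hc4A, hc6A, hc4, eval_hesseC4three]; norm_num)
    (by rw [hc4A, hc6A, hc6, eval_hesseC6three]; norm_num)
  exact kobayashiMainConjecture_of_cmPartner_of_lvalue_of_transfer_OPEN W A 3 hCL hPR h5 h3 (by norm_num)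
    hgood hap (hasCM_cm64a4 hIA) hgoodA hapA hiso (by norm_num) hL'
    (by rw [show ((1 : ℚ) / 4) = ((1 : ℕ) : ℚ) / (4 : ℕ) by norm_num]
        exact padicValRat_natCast_div_natCast_eq_zero 3 1 4 (by norm_num) (by norm_num)) ε

/-- `#{Ẽ(𝔽_3)} = 4` for the Cremona model of `311872h1` (`a_3 = 0`: good SUPERSINGULAR; kernel count).
[cite: Cremona2006, Table 1 (Cremona label 311872h1)] -/
theorem card_c311872h1_3 :
    Nat.card (((⟨0, 0, 0, -115917299, 480364044888⟩ : WeierstrassCurve ℤ).map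
      (Int.castRingHom (ZMod 3))).toAffine.Point) = 4 := by
  rw [@WeierstrassCurve.natCard_point_eq_one_add_card (ZMod 3) (@ZMod.instField 3 ⟨by norm_num⟩) _ _ _
    (by decide +kernel), @card_sol_eq_sum_euler (ZMod 3) (@ZMod.instField 3 ⟨by norm_num⟩) _ _
    (by rw [ZMod.ringChar_zmod_n]; decide), ZMod.card]
  decide +kernel

/-- **Kobayashi's ± main conjecture, BOTH signs, for `311872h1 @ 3`** (Cremona model `[0, 0, 0, -115917299, 480364044888]`, `N = 311872 = 2⁶·11·443`,
`r_an = 0`; item-4 pair: X7, `a_3 = 0`, image `3Nn`) **by CM-congruence transfer from `E' =` `64a4 : y² = x³ + x` (`j = 1728`), MODULO the OPEN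
binder `hCL` (Corpuz–Lei 2025, PRE)**: `E ≅_ℚ` the member `(λ:μ) = (-184:39)` of the Hesse pencil `X_{E'}(3)`, `u = 4/39` (`threeCongruent_of_hesseCertificate_unconditional` — Fisher's `n = 3` fact is PROVED in the tree, so `E[3] ≃ E'[3]` is UNCONDITIONAL); covariant identities by `norm_num`. BY NAME: `hPR`, `h5`, `h3`.
Certificate binder `hL'`: `L(E',1)/Ω(E') = 1/4` (engines PARI kit j250436 / PARI-free modular symbols kit j251201), a `3`-unit (kernel).
Kernel-decided (models as instance binders): `3 ∤ Δ` (both), `#Ẽ(𝔽_3) = #Ẽ'(𝔽_3) = 4`, CM of `E'`. Per pair; item 4 stays OPEN; nothing booked.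
[claim: CorpuzLei2025, status: under-review] [cite: PollackRubin2004, Theorem (p. 448) = Thm. 7.3]
[cite: Fisher2012Hessian, Thm. 13.2 (n = 3)] [cite: Cremona2006, Table 1 (Cremona label 311872h1)] -/
theorem kobayashiMainConjecture_c311872h1_3_of_transfer_OPEN
    (hCL : CorpuzLei2025_signedMainConjecture_transfer_OPEN)
    (hPR : PollackRubin2004.mainTheorem_signedCharIdeal_eq_of_cm)
    (h5 : realPeriodRat_eq_unit_mul_plusPeriod) (h3 : realPeriodRat_eq_unit_mul_plusPeriod_three)
    (W A : WeierstrassCurve ℚ) [W.IsElliptic] [W.IsGloballyMinimal] [A.IsElliptic] [A.IsGloballyMinimal]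
    [Fact (Nat.Prime 3)] (hW : W = ⟨0, 0, 0, -115917299, 480364044888⟩) (hA : A = ⟨0, 0, 0, 1, 0⟩)
    (hL' : A.entireLFunction 1 / (A.realPeriodRat : ℂ) = ((1 / 4 : ℚ) : ℂ)) (ε : ℤˣ) :
    KobayashiMainConjecture W 3 ε := by
  have hIW : integralModelInt W = ⟨0, 0, 0, -115917299, 480364044888⟩ :=
    integralModelInt_eq_of_map_eq _ (by rw [hW]; ext <;> simp [WeierstrassCurve.map])
  have hIA : integralModelInt A = ⟨0, 0, 0, 1, 0⟩ :=
    integralModelInt_eq_of_map_eq _ (by rw [hA]; ext <;> simp [WeierstrassCurve.map])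
  have hΔ : (⟨0, 0, 0, -115917299, 480364044888⟩ : WeierstrassCurve ℤ).Δ = discOf [0, 0, 0, -115917299, 480364044888] :=
    intCurve_Δ 0 0 0 (-115917299) 480364044888
  have hΔA : (⟨0, 0, 0, 1, 0⟩ : WeierstrassCurve ℤ).Δ = discOf [0, 0, 0, 1, 0] :=
    intCurve_Δ 0 0 0 1 0
  have hgood : W.HasGoodReductionAtPrime 3 :=
    hasGoodReductionAtPrime_of_not_dvd W 3 (by rw [minimalDiscriminantInt_eq hIW, hΔ]; decide +kernel)
  have hgoodA : A.HasGoodReductionAtPrime 3 :=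
    hasGoodReductionAtPrime_of_not_dvd A 3 (by rw [minimalDiscriminantInt_eq hIA, hΔA]; decide +kernel)
  have hap : W.frobeniusTrace 3 = 0 := by rw [frobeniusTrace_eq hIW card_c311872h1_3]; norm_num
  have hapA : A.frobeniusTrace 3 = 0 := by rw [frobeniusTrace_eq hIA card_cm64a4_3]; norm_num
  have hc4 : W.c₄ = (5564030352 : ℚ) := by
    subst hW; norm_num [WeierstrassCurve.c₄, WeierstrassCurve.b₂, WeierstrassCurve.b₄]
  have hc6 : W.c₆ = (-415034534783232 : ℚ) := by
    subst hW; norm_num [WeierstrassCurve.c₆, WeierstrassCurve.b₂, WeierstrassCurve.b₄, WeierstrassCurve.b₆]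
  have hc4A : A.c₄ = (-48 : ℚ) := by
    subst hA; norm_num [WeierstrassCurve.c₄, WeierstrassCurve.b₂, WeierstrassCurve.b₄]
  have hc6A : A.c₆ = (0 : ℚ) := by
    subst hA; norm_num [WeierstrassCurve.c₆, WeierstrassCurve.b₂, WeierstrassCurve.b₄, WeierstrassCurve.b₆]
  have hiso := threeCongruent_of_hesseCertificate_unconditional A W ((-184 : ℚ) / 39) 1 ((4 : ℚ) / 39)
    (by norm_num) (by rw [hc4A, hc6A, hc4, eval_hesseC4three]; norm_num)
    (by rw [hc4A, hc6A, hc6, eval_hesseC6three]; norm_num)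
  exact kobayashiMainConjecture_of_cmPartner_of_lvalue_of_transfer_OPEN W A 3 hCL hPR h5 h3 (by norm_num)
    hgood hap (hasCM_cm64a4 hIA) hgoodA hapA hiso (by norm_num) hL'
    (by rw [show ((1 : ℚ) / 4) = ((1 : ℕ) : ℚ) / (4 : ℕ) by norm_num]
        exact padicValRat_natCast_div_natCast_eq_zero 3 1 4 (by norm_num) (by norm_num)) ε

/-- `#{Ẽ(𝔽_3)} = 4` for the Cremona model of `351808bj1` (`a_3 = 0`: good SUPERSINGULAR; kernel count).
[cite: Cremona2006, Table 1 (Cremona label 351808bj1)] -/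
theorem card_c351808bj1_3 :
    Nat.card (((⟨0, 0, 0, -1559, -158648⟩ : WeierstrassCurve ℤ).map
      (Int.castRingHom (ZMod 3))).toAffine.Point) = 4 := by
  rw [@WeierstrassCurve.natCard_point_eq_one_add_card (ZMod 3) (@ZMod.instField 3 ⟨by norm_num⟩) _ _ _
    (by decide +kernel), @card_sol_eq_sum_euler (ZMod 3) (@ZMod.instField 3 ⟨by norm_num⟩) _ _
    (by rw [ZMod.ringChar_zmod_n]; decide), ZMod.card]
  decide +kernel

/-- **Kobayashi's ± main conjecture, BOTH signs, for `351808bj1 @ 3`** (Cremona model `[0, 0, 0, -1559, -158648]`, `N = 351808 = 2⁶·23·239`,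
`r_an = 0`; item-4 pair: X7, `a_3 = 0`, image `3Nn`) **by CM-congruence transfer from `E' =` `64a4 : y² = x³ + x` (`j = 1728`), MODULO the OPEN
binder `hCL` (Corpuz–Lei 2025, PRE)**: `E ≅_ℚ` the member `(λ:μ) = (14:1)` of the Hesse pencil `X_{E'}(3)`, `u = 2` (`threeCongruent_of_hesseCertificate_unconditional` — Fisher's `n = 3` fact is PROVED in the tree, so `E[3] ≃ E'[3]` is UNCONDITIONAL); covariant identities by `norm_num`. BY NAME: `hPR`, `h5`, `h3`.
Certificate binder `hL'`: `L(E',1)/Ω(E') = 1/4` (engines PARI kit j250436 / PARI-free modular symbols kit j251201), a `3`-unit (kernel).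
Kernel-decided (models as instance binders): `3 ∤ Δ` (both), `#Ẽ(𝔽_3) = #Ẽ'(𝔽_3) = 4`, CM of `E'`. Per pair; item 4 stays OPEN; nothing booked.
[claim: CorpuzLei2025, status: under-review] [cite: PollackRubin2004, Theorem (p. 448) = Thm. 7.3]
[cite: Fisher2012Hessian, Thm. 13.2 (n = 3)] [cite: Cremona2006, Table 1 (Cremona label 351808bj1)] -/
theorem kobayashiMainConjecture_c351808bj1_3_of_transfer_OPEN
    (hCL : CorpuzLei2025_signedMainConjecture_transfer_OPEN)
    (hPR : PollackRubin2004.mainTheorem_signedCharIdeal_eq_of_cm)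
    (h5 : realPeriodRat_eq_unit_mul_plusPeriod) (h3 : realPeriodRat_eq_unit_mul_plusPeriod_three)
    (W A : WeierstrassCurve ℚ) [W.IsElliptic] [W.IsGloballyMinimal] [A.IsElliptic] [A.IsGloballyMinimal]
    [Fact (Nat.Prime 3)] (hW : W = ⟨0, 0, 0, -1559, -158648⟩) (hA : A = ⟨0, 0, 0, 1, 0⟩)
    (hL' : A.entireLFunction 1 / (A.realPeriodRat : ℂ) = ((1 / 4 : ℚ) : ℂ)) (ε : ℤˣ) :
    KobayashiMainConjecture W 3 ε := by
  have hIW : integralModelInt W = ⟨0, 0, 0, -1559, -158648⟩ :=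
    integralModelInt_eq_of_map_eq _ (by rw [hW]; ext <;> simp [WeierstrassCurve.map])
  have hIA : integralModelInt A = ⟨0, 0, 0, 1, 0⟩ :=
    integralModelInt_eq_of_map_eq _ (by rw [hA]; ext <;> simp [WeierstrassCurve.map])
  have hΔ : (⟨0, 0, 0, -1559, -158648⟩ : WeierstrassCurve ℤ).Δ = discOf [0, 0, 0, -1559, -158648] :=
    intCurve_Δ 0 0 0 (-1559) (-158648)
  have hΔA : (⟨0, 0, 0, 1, 0⟩ : WeierstrassCurve ℤ).Δ = discOf [0, 0, 0, 1, 0] :=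
    intCurve_Δ 0 0 0 1 0
  have hgood : W.HasGoodReductionAtPrime 3 :=
    hasGoodReductionAtPrime_of_not_dvd W 3 (by rw [minimalDiscriminantInt_eq hIW, hΔ]; decide +kernel)
  have hgoodA : A.HasGoodReductionAtPrime 3 :=
    hasGoodReductionAtPrime_of_not_dvd A 3 (by rw [minimalDiscriminantInt_eq hIA, hΔA]; decide +kernel)
  have hap : W.frobeniusTrace 3 = 0 := by rw [frobeniusTrace_eq hIW card_c351808bj1_3]; norm_num
  have hapA : A.frobeniusTrace 3 = 0 := by rw [frobeniusTrace_eq hIA card_cm64a4_3]; norm_num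
  have hc4 : W.c₄ = (74832 : ℚ) := by
    subst hW; norm_num [WeierstrassCurve.c₄, WeierstrassCurve.b₂, WeierstrassCurve.b₄]
  have hc6 : W.c₆ = (137071872 : ℚ) := by
    subst hW; norm_num [WeierstrassCurve.c₆, WeierstrassCurve.b₂, WeierstrassCurve.b₄, WeierstrassCurve.b₆]
  have hc4A : A.c₄ = (-48 : ℚ) := by
    subst hA; norm_num [WeierstrassCurve.c₄, WeierstrassCurve.b₂, WeierstrassCurve.b₄]
  have hc6A : A.c₆ = (0 : ℚ) := by
    subst hA; norm_num [WeierstrassCurve.c₆, WeierstrassCurve.b₂, WeierstrassCurve.b₄, WeierstrassCurve.b₆]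
  have hiso := threeCongruent_of_hesseCertificate_unconditional A W (14 : ℚ) 1 (2 : ℚ)
    (by norm_num) (by rw [hc4A, hc6A, hc4, eval_hesseC4three]; norm_num)
    (by rw [hc4A, hc6A, hc6, eval_hesseC6three]; norm_num)
  exact kobayashiMainConjecture_of_cmPartner_of_lvalue_of_transfer_OPEN W A 3 hCL hPR h5 h3 (by norm_num)
    hgood hap (hasCM_cm64a4 hIA) hgoodA hapA hiso (by norm_num) hL'
    (by rw [show ((1 : ℚ) / 4) = ((1 : ℕ) : ℚ) / (4 : ℕ) by norm_num]
        exact padicValRat_natCast_div_natCast_eq_zero 3 1 4 (by norm_num) (by norm_num)) ε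

end Summit.BirchSwinnertonDyer.BirchSwinnertonDyer.Theorems

end
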